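import Literature.Geometry.Riemannian.PerelmanNoncollapsingInterior
import Literature.Geometry.Riemannian.MetricCutoff
import Literature.Geometry.Riemannian.CanonicalNeighbourhoodsProofs
import Literature.Geometry.Riemannian.RicciFlowScalarCurvatureHolds
import Literature.Geometry.Riemannian.RicciFlowMaximal
import HarnessLib

/-!
# `SubcylindricalRecognition` — negative knowledge IV: the entropy floor already is no-local-collapsing

Support lemmas for crux `stmt-SmoothPoincare4-10869` (RUNG), picked line `ancient-sphere-rigidity`, reshape r2,
from the standing disprover's work file `Cruxes/SubcylindricalRecognition/Disproof.lean` (§8.2).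

* `isKappaNoncollapsed_of_muFloor` — for every real `m` there is `κ = κ(m, dim) > 0` such that ANY family
  `(g, cov)` on ANY closed manifold whose slices on the time set `S` are Riemannian with `cov t` Levi-Civita and
  satisfy the uniform floor `m ≤ μ(g t, cov t, τ)` for ALL `τ > 0` is `κ`-noncollapsed (parabolic form
  `IsKappaNoncollapsed`) on `S` at EVERY scale `r₀ > 0` — Topping 2006 Thm 8.3.4 / (8.3.11) run on one slice
  (`entropyDichotomy_of_le_muEntropy` + universal cutoffs `exists_metric_cutoff` + the halving iteration
  `ofReal_mul_pow_le_vol_ball_of_doubling`); no flow equation, no monotonicity, no `√T` restriction.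
* `stubBlowdown_nlc_of_floor` — hence hypothesis (6) of the registered stub `stub_blowdown` (uniform
  `κ`-noncollapsing below `√A_k`) follows from its hypotheses (2) Ricci flow, (3) Riemannian, (7) floor
  `μ ≥ ν_cyl + δ'`, with one `κ(δ')` for all `k` and all `M⁴`, at all scales: the NLC threads of
  `stub_singularFlow` (Perelman Thm 4.1) and `stub_rescaledSequence` are not needed by the line.
References: Perelman arXiv:math/0211159 §4; Topping, *Lectures on the Ricci flow* (2006) §8.3.
-/

noncomputable section

set_option linter.dupNamespace false

namespace Summit.SmoothPoincare4.SmoothPoincare4.Theorems.SubcylindricalRecognition.Negative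

open scoped Manifold ContDiff Topology ENNReal NNReal
open MeasureTheory Set Literature.Geometry.Lorentzian Literature.Geometry.Riemannian

universe uE uH uM in
/-- **A uniform `μ`-floor gives `κ`-noncollapsing at EVERY scale, with `κ` depending only on the floor
and the dimension** (Perelman 2002 §4 / Topping 2006 Thm. 8.3.4, (8.3.11), run on ONE slice: the tree's
`entropyDichotomy_of_le_muEntropy` with the universal cutoffs `exists_metric_cutoff` and the halving
iteration `ofReal_mul_pow_le_vol_ball_of_doubling`). For every real `m` there is `κ = κ(m, dim) > 0`
such that for every closed manifold `M`, every family `(g, cov)` and time set `S` whose slices are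
Riemannian with `cov t` Levi-Civita and `m ≤ μ(g t, cov t, τ)` for ALL `τ > 0`, the family is
`κ`-noncollapsed on `S` at every scale `r₀ > 0` (parabolic form `IsKappaNoncollapsed`; only the final
slice of the parabolic region is used). No flow equation, no monotonicity, no `√T` restriction. [folklore] -/
theorem isKappaNoncollapsed_of_muFloor
    {E : Type uE} [NormedAddCommGroup E] [NormedSpace ℝ E] [FiniteDimensional ℝ E]
    {H : Type uH} [TopologicalSpace H] (I : ModelWithCorners ℝ E H) [I.Boundaryless] (m : ℝ) :
    ∃ κ : ℝ, 0 < κ ∧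
      ∀ (M : Type uM) [TopologicalSpace M] [T2Space M] [SecondCountableTopology M] [CompactSpace M]
        [ChartedSpace H M] [IsManifold I ∞ M] [T3Space M] [MeasurableSpace M] [BorelSpace M]
        (g : ℝ → PseudoRiemannianMetric I ∞ E (TangentSpace I : M → Type _))
        (cov : ℝ → CovariantDerivative I E (TangentSpace I : M → Type _)) (S : Set ℝ),
        (∀ t ∈ S, (g t).IsRiemannian) → (∀ t ∈ S, (g t).IsLeviCivita (cov t)) →
        (∀ t ∈ S, ∀ τ : ℝ, 0 < τ → (m : EReal) ≤ (g t).muEntropy (cov t) τ) →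
        ∀ r₀ : ℝ, 0 < r₀ → IsKappaNoncollapsed g cov S κ r₀ := by
  haveI : CompleteSpace E := FiniteDimensional.complete ℝ E
  obtain ⟨C₀, hC₀⟩ := exists_metric_cutoff.{uE, uH, uM}
  set n := Module.finrank ℝ E with hn
  refine ⟨(Real.pi / 9) ^ ((n : ℝ) / 2) *
      Real.exp (m + n - (C₀ / 9 + (n : ℝ) ^ 2) * 2 ^ (n + 1)), by positivity, ?_⟩
  intro M _ _ _ _ _ _ _ _ _ g cov S hRiem hLC hfloor r₀ hr₀ x₀ t₀ hS hcurv
  have ht₀I : t₀ ∈ Icc (t₀ - r₀ ^ 2) t₀ := ⟨by nlinarith, le_rfl⟩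
  have ht₀ : t₀ ∈ S := hS ht₀I
  have hG : (g t₀).IsRiemannian := hRiem t₀ ht₀
  have hRc : Continuous fun x ↦ (g t₀).scalarCurvatureWith (cov t₀) x :=
    (contMDiff_scalarCurvatureWith_holds I M (g t₀) (cov t₀) (hLC t₀ ht₀)).continuous
  refine PseudoRiemannianMetric.ofReal_mul_pow_le_vol_ball_of_doubling hG x₀ hr₀ (by positivity)
    fun s hs hsr hdoub ↦ ?_
  obtain ⟨χ, hχs, hχ0, hχ1, hχB, hχsupp, hχK⟩ := hC₀ I M (g t₀) hG x₀ s hs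
  refine entropyDichotomy_of_le_muEntropy hG hRc hs hχs hχ0 hχ1 hχB hχsupp hχK
    (hfloor t₀ ht₀ _ (by positivity)) ?_ hdoub
  refine (hcurv t₀ ht₀I).mono
    (PseudoRiemannianMetric.ball_mono _ _ (ENNReal.ofReal_le_ofReal hsr)) ?_
  gcongr

/-- **Hypothesis (6) of `stub_blowdown` (uniform `κ`-noncollapsing below `√A_k`) follows from hypotheses
(2) [Ricci flow ⇒ Levi-Civita slices], (3) [Riemannian] and (7) [the floor `μ ≥ ν_cyl + δ'`]** — in the
stronger form: ALL scales `r₀ > 0`, one `κ = κ(δ')` for every `k` and every closed `M⁴`. Information for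
the lead: `hnc`/`hκ` are removable from `stub_blowdown`, and the NLC clauses of `stub_singularFlow`
(Perelman's Thm 4.1) and `stub_rescaledSequence` are then not needed by the chain at all — the crux's
floor hypothesis is itself a no-local-collapsing statement. [folklore] -/
theorem stubBlowdown_nlc_of_floor (δ' : ℝ) : ∃ κ : ℝ, 0 < κ ∧
    ∀ (M : Type) [TopologicalSpace M] [T2Space M] [SecondCountableTopology M]
      [ChartedSpace (EuclideanSpace ℝ (Fin 4)) M] [IsManifold (𝓡 4) ∞ M] [CompactSpace M]
      [T3Space M] [MeasurableSpace M] [BorelSpace M]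
      (A : ℕ → ℝ)
      (gk : ℕ → ℝ → PseudoRiemannianMetric (𝓡 4) ∞ (EuclideanSpace ℝ (Fin 4)) (TangentSpace (𝓡 4) : M → Type _))
      (covk : ℕ → ℝ → CovariantDerivative (𝓡 4) (EuclideanSpace ℝ (Fin 4)) (TangentSpace (𝓡 4) : M → Type _)),
      (∀ k, IsRicciFlow (gk k) (covk k) (Set.Icc (-(A k)) 0)) →
      (∀ k, ∀ t ∈ Set.Icc (-(A k)) 0, (gk k t).IsRiemannian) →
      (∀ k, ∀ t ∈ Set.Icc (-(A k)) 0, ∀ τ : ℝ, 0 < τ →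
        ((Real.log 2 + Real.log Real.pi / 2 - 3 / 2 + δ' : ℝ) : EReal) ≤
          (gk k t).muEntropy (covk k t) τ) →
      ∀ k, ∀ r₀ : ℝ, 0 < r₀ → IsKappaNoncollapsed (gk k) (covk k) (Set.Icc (-(A k)) 0) κ r₀ := by
  obtain ⟨κ, hκ, H⟩ := isKappaNoncollapsed_of_muFloor.{0, 0, 0} (𝓡 4)
    (Real.log 2 + Real.log Real.pi / 2 - 3 / 2 + δ')
  refine ⟨κ, hκ, fun M _ _ _ _ _ _ _ _ _ A gk covk hflow hRiem hfloor k r₀ hr₀ ↦ ?_⟩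
  exact H M (gk k) (covk k) (Set.Icc (-(A k)) 0) (hRiem k)
    (fun t ht ↦ (hflow k).isLeviCivita t ht) (hfloor k) r₀ hr₀

end Summit.SmoothPoincare4.SmoothPoincare4.Theorems.SubcylindricalRecognition.Negative

end
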